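import Summits.CriticalPhenomena.PercolationContinuityZ3.Theorems.Transplant.FKConnectivityAllQAntipodalOrAttTPath
import Summits.CriticalPhenomena.PercolationContinuityZ3.Theorems.Transplant.FKConnectivityAllQAntipodalAndPlus
import HarnessLib

/-!
# Connectivity correlation inequalities for `φ_{w,q}`, every `q > 0` — file 63f: CONJECTURE `C_∞⁺` FOR THE TYPE `x ∧ AND(T) ∧ (y ∨ z)` —
# every cell, every antitone level weight, every 2-connected series–parallel graph (the level-4 extreme type T1 = `zw(x ∨ y)` is `|T| = 1`)

Support file (`--supports stmt-CriticalPhenomena-4575`), FK sub-lane `prim-bschramm-fk-2` (gen 29; memo FROM-fk-2-g29-BRIDGE §6, §11); builds on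
p205010 (kernel theorem, internal audit signed; external expert review pending).  No definitions, no named facts, no sorries; standard axioms.

* `FK.apPsiCW_orAttTInd_eq` — the bridge: for `f = 1{x ∈ · ∧ T ⊆ · ∧ (y ∈ · ∨ z ∈ ·)}` (`x, y, z, T` off `N ∪ C`, `g` not reading them) the
  weighted antipodal form of the cell `(N ∪ {y, z} ∪ {x} ∪ T, C)` equals `2 · O_{T∪C}(N; y, z; C)` with root `x` (inclusion–exclusion
  `f = AND(xTy) + AND(xTz) − AND(xTyz)` and gen 21's AND bridge `FK.apPsiCW_andInd_eq` three times).
* **`FK.apPsiCW_orAttT_nonpos_of_isTTSP`** — `E` TTSP between `s, t`, `st ∉ E`, `N, T, C ⊆ E` pairwise disjoint, `y ≠ z ∈ E` outside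
  `N ∪ T ∪ C`, `w` ANTITONE, `g` increasing and not reading `st, T, y, z` ⟹ the weighted antipodal form of `f` is `≤ 0`
  (`FK.orAttTW_drift_nonpos_of_isTTSP` with `A = T ∪ C`).
* `FK.apPsiC_levels_le_orAttT_nonpos_of_isTTSP` — every coefficient, in the edge odds AND in `q`, of `Z_H(z,q)² Cov_{φ_{z,q}}(f, g)/(q−1)` is
  `≥ 0`: Conjecture `C_∞⁺` for the family `ω_x · AND(ω_T) · (ω_y ∨ ω_z)` on series–parallel graphs, in particular for the LEVEL-4 type T1
  (root placed in the AND pair; any edge of a 2-connected series–parallel graph can serve as the root, `IsTTSP.reroot_erase`);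
  `FK.apPsiC_orAttT_nonpos_of_levels` — all `0 ≤ q ≤ 1` via the Abel bridge of `…Qfree`.
With `…OrAttPlus` (`|T| = 0`) and `…AndPlus` (`y = z` degenerate) this completes the AND/OR-attached family; of gen 29's two level-4 types only
T2 = `2x+y+z+w ≥ 3` remains (memo §8: its series-gluing square is open).
[cite: Grimmett2006, §1.4 eq. (1.20) (p. 15); §3.8 Thm. (3.90) (pp. 61–62); §3.9 (pp. 63–64)] [cite: Wagner2006, Thm. 5.8(d), §5.3]
-/

noncomputable section

namespace Summit.CriticalPhenomena.PercolationContinuityZ3.Theorems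

namespace FK

open SimpleGraph Literature.Probability.LatticeModels Literature.Probability.Percolation
open scoped Classical

variable {V : Type*} [Fintype V]

section OrAttTPlus

omit [Fintype V] in
/-- Inclusion–exclusion for the indicator of `S ⊆ X ∧ (y ∈ X ∨ z ∈ X)`. [folklore] -/
theorem orAttTInd_eq (S X : Finset (Sym2 V)) (y z : Sym2 V) :
    (if S ⊆ X ∧ (y ∈ X ∨ z ∈ X) then (1 : ℝ) else 0) =
      (if insert y S ⊆ X then (1 : ℝ) else 0) + (if insert z S ⊆ X then (1 : ℝ) else 0) -
        (if insert y (insert z S) ⊆ X then (1 : ℝ) else 0) := by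
  simp only [Finset.insert_subset_iff]
  by_cases hS : S ⊆ X <;> by_cases hy : y ∈ X <;> by_cases hz : z ∈ X <;> simp [hS, hy, hz]

omit [Fintype V] in
/-- The weighted antipodal form of a cell is additive in the observable (linearity of the bridge). [folklore] -/
theorem apPsiCW_obs_incl_excl (w : ℕ → ℝ) (M C : Finset (Sym2 V)) (F F₁ F₂ F₃ g : Finset (Sym2 V) → ℝ)
    (hF : ∀ X, F X = F₁ X + F₂ X - F₃ X) :
    ∑ γ ∈ M.powerset, w (apExpC M C γ) * ((F (γ ∪ C) - F (M \ γ ∪ C)) * (g (γ ∪ C) - g (M \ γ ∪ C))) =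
      ∑ γ ∈ M.powerset, w (apExpC M C γ) * ((F₁ (γ ∪ C) - F₁ (M \ γ ∪ C)) * (g (γ ∪ C) - g (M \ γ ∪ C))) +
        ∑ γ ∈ M.powerset, w (apExpC M C γ) * ((F₂ (γ ∪ C) - F₂ (M \ γ ∪ C)) * (g (γ ∪ C) - g (M \ γ ∪ C))) -
        ∑ γ ∈ M.powerset, w (apExpC M C γ) * ((F₃ (γ ∪ C) - F₃ (M \ γ ∪ C)) * (g (γ ∪ C) - g (M \ γ ∪ C))) := by
  rw [← Finset.sum_add_distrib, ← Finset.sum_sub_distrib]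
  refine Finset.sum_congr rfl fun γ _ => ?_
  rw [hF, hF]; ring

omit [Fintype V] in
/-- One AND bridge with one extra free edge `e` not read by `g`: the drift of `(N ∪ {e}; S' | ·)` splits by the position of `e` into the two
drifts `(eS' | ·)` and `(S' | e·)`. [cite: Grimmett2006, §1.4 eq. (1.20) (p. 15)] -/
theorem andDrift_split_free (w : ℕ → ℝ) {N : Finset (Sym2 V)} (S' C : Finset (Sym2 V)) {e : Sym2 V} (heN : e ∉ N)
    {g : Finset (Sym2 V) → ℝ} (hge : ∀ A : Finset (Sym2 V), g (insert e A) = g A) :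
    ∑ γ ∈ (insert e N).powerset, (w (clusterCount (↑(γ ∪ S' ∪ C) : BondConfig V) ∅ + clusterCount (↑(insert e N \ γ ∪ C) : BondConfig V) ∅) -
        w (clusterCount (↑(insert e N \ γ ∪ S' ∪ C) : BondConfig V) ∅ + clusterCount (↑(γ ∪ C) : BondConfig V) ∅)) * g (γ ∪ C) =
      ∑ γ ∈ N.powerset, (w (clusterCount (↑(γ ∪ S' ∪ C) : BondConfig V) ∅ + clusterCount (↑(N \ γ ∪ insert e C) : BondConfig V) ∅) -
          w (clusterCount (↑(N \ γ ∪ S' ∪ C) : BondConfig V) ∅ + clusterCount (↑(γ ∪ insert e C) : BondConfig V) ∅)) * g (γ ∪ C) +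
      ∑ γ ∈ N.powerset, (w (clusterCount (↑(γ ∪ insert e S' ∪ C) : BondConfig V) ∅ + clusterCount (↑(N \ γ ∪ C) : BondConfig V) ∅) -
          w (clusterCount (↑(N \ γ ∪ insert e S' ∪ C) : BondConfig V) ∅ + clusterCount (↑(γ ∪ C) : BondConfig V) ∅)) * g (γ ∪ C) := by
  rw [Finset.sum_powerset_insert heN, ← Finset.sum_add_distrib, ← Finset.sum_add_distrib]
  have h₁ : ∀ γ ∈ N.powerset, insert e N \ γ = insert e (N \ γ) := fun γ hγ =>
    Finset.insert_sdiff_of_notMem _ (fun hh => heN (Finset.mem_powerset.1 hγ hh))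
  have h₂ : ∀ γ ∈ N.powerset, insert e N \ insert e γ = N \ γ := fun γ hγ => by
    rw [Finset.insert_sdiff_insert, Finset.sdiff_insert_of_notMem heN]
  refine (Finset.sum_congr rfl fun γ hγ => ?_)
  rw [h₁ γ hγ, h₂ γ hγ]
  have e1 : insert e (N \ γ) ∪ C = N \ γ ∪ insert e C := by rw [Finset.insert_union, Finset.union_insert]
  have e2 : insert e (N \ γ) ∪ S' ∪ C = N \ γ ∪ insert e S' ∪ C := by rw [Finset.insert_union, Finset.union_insert]
  have e3 : insert e γ ∪ S' ∪ C = γ ∪ insert e S' ∪ C := by rw [Finset.insert_union, Finset.union_insert]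
  have e4 : insert e γ ∪ C = γ ∪ insert e C := by rw [Finset.insert_union, Finset.union_insert]
  have hg' : g (insert e γ ∪ C) = g (γ ∪ C) := by rw [Finset.insert_union, hge]
  rw [hg', e1, e2, e3, e4]
  ring


omit [Fintype V] in
/-- **Bridge.**  For distinct `x, y, z` and a set `T`, all off `N ∪ C`, and `g` not reading `x, y, z, T`: the weighted antipodal form of
`f = 1{x ∈ · ∧ T ⊆ · ∧ (y ∈ · ∨ z ∈ ·)}` in the cell `(N ∪ {y, z, x} ∪ T, C)` is twice `O_{T∪C}(N; y, z; C)` with root `x` (inclusion–exclusion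
`f = AND(xTy) + AND(xTz) − AND(xTyz)` and the AND bridge `FK.apPsiCW_andInd_eq`, the extra free special regrouped by `FK.andDrift_split_free`).
[cite: Grimmett2006, §1.4 eq. (1.20) (p. 15); §3.8 (pp. 61–62)] -/
theorem apPsiCW_orAttTInd_eq (w : ℕ → ℝ) {N T C : Finset (Sym2 V)} {x y z : Sym2 V}
    (hxN : x ∉ N) (hyN : y ∉ N) (hzN : z ∉ N) (hxC : x ∉ C) (hyC : y ∉ C) (hzC : z ∉ C) (hyT : y ∉ T) (hzT : z ∉ T)
    (hNT : Disjoint N T) (hTC : Disjoint T C) (hxy : x ≠ y) (hxz : x ≠ z) (hyz : y ≠ z)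
    {g : Finset (Sym2 V) → ℝ} (hg : ∀ A U : Finset (Sym2 V), U ⊆ insert y (insert z (insert x T)) → g (A ∪ U) = g A) :
    ∑ γ ∈ (N ∪ insert y (insert z (insert x T))).powerset, w (apExpC (N ∪ insert y (insert z (insert x T))) C γ) *
        ((((fun X : Finset (Sym2 V) => if insert x T ⊆ X ∧ (y ∈ X ∨ z ∈ X) then (1 : ℝ) else 0) (γ ∪ C)) - ((fun X : Finset (Sym2 V) => if insert x T ⊆ X ∧ (y ∈ X ∨ z ∈ X) then (1 : ℝ) else 0) ((N ∪ insert y (insert z (insert x T))) \ γ ∪ C))) * (g (γ ∪ C) - g ((N ∪ insert y (insert z (insert x T))) \ γ ∪ C))) =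
      2 * (∑ γ ∈ N.powerset,
          (w (clusterCount (↑(insert x (γ ∪ insert y (insert z (T ∪ C)))) : BondConfig V) ∅ + clusterCount (↑(N \ γ ∪ C) : BondConfig V) ∅) -
            w (clusterCount (↑(insert x (N \ γ ∪ insert y (insert z (T ∪ C)))) : BondConfig V) ∅ + clusterCount (↑(γ ∪ C) : BondConfig V) ∅)) * g (γ ∪ C) +
        ∑ γ ∈ N.powerset,
          (w (clusterCount (↑(insert x (γ ∪ insert z (T ∪ C))) : BondConfig V) ∅ + clusterCount (↑(N \ γ ∪ insert y C) : BondConfig V) ∅) -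
            w (clusterCount (↑(insert x (N \ γ ∪ insert z (T ∪ C))) : BondConfig V) ∅ + clusterCount (↑(γ ∪ insert y C) : BondConfig V) ∅)) * g (γ ∪ C) +
        ∑ γ ∈ N.powerset,
          (w (clusterCount (↑(insert x (γ ∪ insert y (T ∪ C))) : BondConfig V) ∅ + clusterCount (↑(N \ γ ∪ insert z C) : BondConfig V) ∅) -
            w (clusterCount (↑(insert x (N \ γ ∪ insert y (T ∪ C))) : BondConfig V) ∅ + clusterCount (↑(γ ∪ insert z C) : BondConfig V) ∅)) * g (γ ∪ C)) := by
  -- inclusion–exclusion on the observable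
  rw [apPsiCW_obs_incl_excl w (N ∪ insert y (insert z (insert x T))) C (fun X : Finset (Sym2 V) => if insert x T ⊆ X ∧ (y ∈ X ∨ z ∈ X) then (1 : ℝ) else 0)
    (fun X : Finset (Sym2 V) => if insert y (insert x T) ⊆ X then (1 : ℝ) else 0)
    (fun X : Finset (Sym2 V) => if insert z (insert x T) ⊆ X then (1 : ℝ) else 0)
    (fun X : Finset (Sym2 V) => if insert y (insert z (insert x T)) ⊆ X then (1 : ℝ) else 0) g
    (fun X => orAttTInd_eq (insert x T) X y z)]
  -- `g` ignores `y` and `z`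
  have hgy : ∀ A : Finset (Sym2 V), g (insert y A) = g A := fun A => by
    rw [Finset.insert_eq, Finset.union_comm]; exact hg A {y} (by simp)
  have hgz : ∀ A : Finset (Sym2 V), g (insert z A) = g A := fun A => by
    rw [Finset.insert_eq, Finset.union_comm]; exact hg A {z} (by simp)
  -- disjointness bookkeeping
  have hNS₃ : Disjoint N (insert y (insert z (insert x T))) :=
    Finset.disjoint_insert_right.2 ⟨hyN, Finset.disjoint_insert_right.2 ⟨hzN, Finset.disjoint_insert_right.2 ⟨hxN, hNT⟩⟩⟩
  have hSC₃ : Disjoint (insert y (insert z (insert x T))) C :=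
    Finset.disjoint_insert_left.2 ⟨hyC, Finset.disjoint_insert_left.2 ⟨hzC, Finset.disjoint_insert_left.2 ⟨hxC, hTC⟩⟩⟩
  have hNS₁ : Disjoint (insert z N) (insert y (insert x T)) :=
    Finset.disjoint_insert_left.2 ⟨by rw [Finset.mem_insert, Finset.mem_insert, not_or, not_or]; exact ⟨fun h => hyz h.symm, fun h => hxz h.symm, hzT⟩,
      Finset.disjoint_insert_right.2 ⟨hyN, Finset.disjoint_insert_right.2 ⟨hxN, hNT⟩⟩⟩
  have hSC₁ : Disjoint (insert y (insert x T)) C := Finset.disjoint_insert_left.2 ⟨hyC, Finset.disjoint_insert_left.2 ⟨hxC, hTC⟩⟩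
  have hNS₂ : Disjoint (insert y N) (insert z (insert x T)) :=
    Finset.disjoint_insert_left.2 ⟨by rw [Finset.mem_insert, Finset.mem_insert, not_or, not_or]; exact ⟨hyz, fun h => hxy h.symm, hyT⟩,
      Finset.disjoint_insert_right.2 ⟨hzN, Finset.disjoint_insert_right.2 ⟨hxN, hNT⟩⟩⟩
  have hSC₂ : Disjoint (insert z (insert x T)) C := Finset.disjoint_insert_left.2 ⟨hzC, Finset.disjoint_insert_left.2 ⟨hxC, hTC⟩⟩
  have hg₁ : ∀ A U : Finset (Sym2 V), U ⊆ insert y (insert x T) → g (A ∪ U) = g A := fun A U hU =>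
    hg A U (hU.trans (Finset.insert_subset_insert _ (Finset.subset_insert _ _)))
  have hg₂ : ∀ A U : Finset (Sym2 V), U ⊆ insert z (insert x T) → g (A ∪ U) = g A := fun A U hU =>
    hg A U (hU.trans (Finset.subset_insert _ _))
  -- the cell as the three unions `Nᵢ ∪ Sᵢ`
  have eM₁ : (N ∪ insert y (insert z (insert x T))) = insert z N ∪ insert y (insert x T) := by
    simp only [Finset.union_insert, Finset.insert_union]
    ext e; simp only [Finset.mem_insert, Finset.mem_union]; tauto
  have eM₂ : (N ∪ insert y (insert z (insert x T))) = insert y N ∪ insert z (insert x T) := by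
    simp only [Finset.union_insert, Finset.insert_union]
    ext e; simp only [Finset.mem_insert, Finset.mem_union]; tauto
  have b₁ := apPsiCW_andInd_eq w hNS₁ ⟨y, Finset.mem_insert_self _ _⟩ hSC₁ hg₁
  have b₂ := apPsiCW_andInd_eq w hNS₂ ⟨z, Finset.mem_insert_self _ _⟩ hSC₂ hg₂
  have b₃ := apPsiCW_andInd_eq w hNS₃ ⟨y, Finset.mem_insert_self _ _⟩ hSC₃ hg
  rw [← eM₁, andDrift_split_free w (insert y (insert x T)) C hzN hgz] at b₁
  rw [← eM₂, andDrift_split_free w (insert z (insert x T)) C hyN hgy] at b₂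
  -- normalise the attached sets to the root-side form of `O_{T∪C}`
  have s₁ : ∀ X : Finset (Sym2 V), X ∪ insert y (insert x T) ∪ C = insert x (X ∪ insert y (T ∪ C)) := fun X => by
    simp only [Finset.union_insert, Finset.insert_union, Finset.union_assoc]; rw [Finset.insert_comm]
  have s₂ : ∀ X : Finset (Sym2 V), X ∪ insert z (insert y (insert x T)) ∪ C = insert x (X ∪ insert y (insert z (T ∪ C))) := fun X => by
    simp only [Finset.union_insert, Finset.insert_union, Finset.union_assoc]
    rw [Finset.insert_comm z y, Finset.insert_comm z x, Finset.insert_comm y x]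
  have s₃ : ∀ X : Finset (Sym2 V), X ∪ insert z (insert x T) ∪ C = insert x (X ∪ insert z (T ∪ C)) := fun X => by
    simp only [Finset.union_insert, Finset.insert_union, Finset.union_assoc]; rw [Finset.insert_comm]
  have s₄ : ∀ X : Finset (Sym2 V), X ∪ insert y (insert z (insert x T)) ∪ C = insert x (X ∪ insert y (insert z (T ∪ C))) := fun X => by
    simp only [Finset.union_insert, Finset.insert_union, Finset.union_assoc]
    rw [Finset.insert_comm z x, Finset.insert_comm y x]
  simp only [s₁, s₂] at b₁
  simp only [s₃, s₄] at b₂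
  simp only [s₄] at b₃
  linear_combination b₁ + b₂ - b₃

/-- **THEOREM (Conjecture `C_∞⁺` for the type `x ∧ AND(T) ∧ (y ∨ z)` — every cell, every antitone weight).**  `E` TTSP between `s, t`,
`st ∉ E` (`H = E ∪ {st}` any 2-connected series–parallel graph presented from the edge `x = st`), `N, T, C ⊆ E` pairwise disjoint
(free / attached / contracted), `y ≠ z ∈ E` outside `N ∪ T ∪ C`, `w` antitone, `g` increasing and not reading `x, y, z, T` ⟹ the weighted antipodal
form of `f = 1{x ∈ · ∧ T ⊆ · ∧ (y ∈ · ∨ z ∈ ·)}` against `g` in the cell `(N ∪ {y,z,x} ∪ T, C)` is `≤ 0`.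
[cite: Grimmett2006, §3.8 Thm. (3.90) (pp. 61–62); §3.9 (pp. 63–64)] [cite: Wagner2006, Thm. 5.8(d), §5.3] -/
theorem apPsiCW_orAttT_nonpos_of_isTTSP {E : Finset (Sym2 V)} {s t : V}
    (hE : IsTTSP E s t) (hst : s(s, t) ∉ E) {N T C : Finset (Sym2 V)} {y z : Sym2 V} (hN : N ⊆ E) (hT : T ⊆ E) (hC : C ⊆ E)
    (hy : y ∈ E) (hz : z ∈ E) (hyz : y ≠ z) (hyN : y ∉ N) (hzN : z ∉ N) (hyT : y ∉ T) (hzT : z ∉ T) (hyC : y ∉ C) (hzC : z ∉ C)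
    (hNT : Disjoint N T) (hNC : Disjoint N C) (hTC : Disjoint T C)
    {w : ℕ → ℝ} (hw : ∀ n : ℕ, w (n + 1) ≤ w n)
    {g : Finset (Sym2 V) → ℝ} (hg : ∀ A U : Finset (Sym2 V), U ⊆ insert y (insert z (insert s(s, t) T)) → g (A ∪ U) = g A)
    (hmono : ∀ ⦃X Y : Finset (Sym2 V)⦄, X ⊆ Y → g X ≤ g Y) :
    ∑ γ ∈ (N ∪ insert y (insert z (insert s(s, t) T))).powerset, w (apExpC (N ∪ insert y (insert z (insert s(s, t) T))) C γ) *
        ((((fun X : Finset (Sym2 V) => if insert s(s, t) T ⊆ X ∧ (y ∈ X ∨ z ∈ X) then (1 : ℝ) else 0) (γ ∪ C)) - ((fun X : Finset (Sym2 V) => if insert s(s, t) T ⊆ X ∧ (y ∈ X ∨ z ∈ X) then (1 : ℝ) else 0) ((N ∪ insert y (insert z (insert s(s, t) T))) \ γ ∪ C))) * (g (γ ∪ C) - g ((N ∪ insert y (insert z (insert s(s, t) T))) \ γ ∪ C))) ≤ 0 := by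
  have hxN : s(s, t) ∉ N := fun hh => hst (hN hh)
  have hxC : s(s, t) ∉ C := fun hh => hst (hC hh)
  have hxy : s(s, t) ≠ y := fun hh => hst (hh ▸ hy)
  have hxz : s(s, t) ≠ z := fun hh => hst (hh ▸ hz)
  rw [apPsiCW_orAttTInd_eq w hxN hyN hzN hxC hyC hzC hyT hzT hNT hTC hxy hxz hyz hg]
  have main := orAttTW_drift_nonpos_of_isTTSP E.card le_rfl hE hst hN (A := T ∪ C) (C := C) (Finset.union_subset hT hC)
    Finset.subset_union_right hy hz hyz hyN hzN
    (by rw [Finset.mem_union, not_or]; exact ⟨hyT, hyC⟩) (by rw [Finset.mem_union, not_or]; exact ⟨hzT, hzC⟩)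
    (Finset.disjoint_union_right.2 ⟨hNT, hNC⟩) w hw (fun γ => g (γ ∪ C))
    (fun X Y hXY _ => hmono (Finset.union_subset_union hXY le_rfl))
  linarith

/-- **COROLLARY (partial sums by cluster level): every coefficient — in the edge odds AND in `q` — of
`Z_H(z,q)² Cov_{φ_{z,q}}(1{ω_x ∧ AND(ω_T) ∧ (ω_y ∨ ω_z)}, g)/(q−1)` is `≥ 0` on series–parallel graphs**: Conjecture `C_∞⁺` for this family,
in particular for the level-4 extreme type T1 (`|T| = 1`). [cite: Grimmett2006, §3.8 Thm. (3.90) (pp. 61–62); §3.9 (pp. 63–64)] [cite: Wagner2006, Thm. 5.8(d), §5.3] -/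
theorem apPsiC_levels_le_orAttT_nonpos_of_isTTSP {E : Finset (Sym2 V)} {s t : V}
    (hE : IsTTSP E s t) (hst : s(s, t) ∉ E) {N T C : Finset (Sym2 V)} {y z : Sym2 V} (hN : N ⊆ E) (hT : T ⊆ E) (hC : C ⊆ E)
    (hy : y ∈ E) (hz : z ∈ E) (hyz : y ≠ z) (hyN : y ∉ N) (hzN : z ∉ N) (hyT : y ∉ T) (hzT : z ∉ T) (hyC : y ∉ C) (hzC : z ∉ C)
    (hNT : Disjoint N T) (hNC : Disjoint N C) (hTC : Disjoint T C) (J : ℕ)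
    {g : Finset (Sym2 V) → ℝ} (hg : ∀ A U : Finset (Sym2 V), U ⊆ insert y (insert z (insert s(s, t) T)) → g (A ∪ U) = g A)
    (hmono : ∀ ⦃X Y : Finset (Sym2 V)⦄, X ⊆ Y → g X ≤ g Y) :
    ∑ γ ∈ (N ∪ insert y (insert z (insert s(s, t) T))).powerset with apExpC (N ∪ insert y (insert z (insert s(s, t) T))) C γ ≤ J,
        ((((fun X : Finset (Sym2 V) => if insert s(s, t) T ⊆ X ∧ (y ∈ X ∨ z ∈ X) then (1 : ℝ) else 0) (γ ∪ C)) - ((fun X : Finset (Sym2 V) => if insert s(s, t) T ⊆ X ∧ (y ∈ X ∨ z ∈ X) then (1 : ℝ) else 0) ((N ∪ insert y (insert z (insert s(s, t) T))) \ γ ∪ C))) * (g (γ ∪ C) - g ((N ∪ insert y (insert z (insert s(s, t) T))) \ γ ∪ C))) ≤ 0 := by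
  have key := apPsiCW_orAttT_nonpos_of_isTTSP hE hst hN hT hC hy hz hyz hyN hzN hyT hzT hyC hzC hNT hNC hTC
    (w := fun n => if n ≤ J then (1 : ℝ) else 0)
    (fun n => by
      split_ifs with h1 h2 h2
      · exact le_rfl
      · exact absurd ((Nat.le_succ n).trans h1) h2
      · exact zero_le_one
      · exact le_rfl) hg hmono
  rw [Finset.sum_filter]
  refine le_of_eq_of_le (Finset.sum_congr rfl fun γ _ => ?_) key
  split_ifs <;> ring

/-- **COROLLARY (the type `x ∧ AND(T) ∧ (y ∨ z)` of Conjecture `C_∞` for all `0 ≤ q ≤ 1`, every cell, via the Abel bridge of `…Qfree`).**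
[cite: Grimmett2006, §3.8 Thm. (3.90) (pp. 61–62); §3.9 (pp. 63–64)] [cite: Wagner2006, Thm. 5.8(d), §5.3] -/
theorem apPsiC_orAttT_nonpos_of_levels {q : ℝ} (hq0 : 0 ≤ q) (hq1 : q ≤ 1) {E : Finset (Sym2 V)} {s t : V}
    (hE : IsTTSP E s t) (hst : s(s, t) ∉ E) {N T C : Finset (Sym2 V)} {y z : Sym2 V} (hN : N ⊆ E) (hT : T ⊆ E) (hC : C ⊆ E)
    (hy : y ∈ E) (hz : z ∈ E) (hyz : y ≠ z) (hyN : y ∉ N) (hzN : z ∉ N) (hyT : y ∉ T) (hzT : z ∉ T) (hyC : y ∉ C) (hzC : z ∉ C)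
    (hNT : Disjoint N T) (hNC : Disjoint N C) (hTC : Disjoint T C)
    {g : Finset (Sym2 V) → ℝ} (hg : ∀ A U : Finset (Sym2 V), U ⊆ insert y (insert z (insert s(s, t) T)) → g (A ∪ U) = g A)
    (hmono : ∀ ⦃X Y : Finset (Sym2 V)⦄, X ⊆ Y → g X ≤ g Y) :
    apPsiC q (N ∪ insert y (insert z (insert s(s, t) T))) C (fun X : Finset (Sym2 V) => if insert s(s, t) T ⊆ X ∧ (y ∈ X ∨ z ∈ X) then (1 : ℝ) else 0) g ≤ 0 :=
  sum_pow_mul_nonpos_of_levels_le (N ∪ insert y (insert z (insert s(s, t) T))).powerset (apExpC (N ∪ insert y (insert z (insert s(s, t) T))) C)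
    (fun γ => (((fun X : Finset (Sym2 V) => if insert s(s, t) T ⊆ X ∧ (y ∈ X ∨ z ∈ X) then (1 : ℝ) else 0) (γ ∪ C)) - ((fun X : Finset (Sym2 V) => if insert s(s, t) T ⊆ X ∧ (y ∈ X ∨ z ∈ X) then (1 : ℝ) else 0) ((N ∪ insert y (insert z (insert s(s, t) T))) \ γ ∪ C))) * (g (γ ∪ C) - g ((N ∪ insert y (insert z (insert s(s, t) T))) \ γ ∪ C)))
    hq0 hq1 fun J => apPsiC_levels_le_orAttT_nonpos_of_isTTSP hE hst hN hT hC hy hz hyz hyN hzN hyT hzT hyC hzC hNT hNC hTC J hg hmono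

end OrAttTPlus

end FK

end Summit.CriticalPhenomena.PercolationContinuityZ3.Theorems

end
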